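import Mathlib.Analysis.Normed.Field.Basic
import Mathlib.Analysis.Normed.Module.FiniteDimension
import Mathlib.Topology.MetricSpace.ProperSpace
import Mathlib.Topology.Order.Basic
import HarnessLib

/-!
# [GenEll] Thm 2.1 for `ℙ¹` (route piece W7-t): properness of `t = 1/r + r^k/s` on the cyclic cover
# `D_e : r^e = x(1 − x)` — points far from the fibre `t⁻¹(b)` have `t` far from `b`

Support lemma for the cell's number-field-only proof architecture of `GenEllTwo` (stmt-ABC-19679;
S. Mochizuki, *Arithmetic elliptic curves in general position*, Math. J. Okayama Univ. **52** (2010),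
Thm. 2.1, proof p. 12: "the compactness of the set of rational points … over any finite extension of
`ℚ_v`" [cite: MochizukiGenEll2010, Thm 2.1 p.12]; package map `GENELLTWO-P1ROUTE.md` of seat
abc-iut-S6, §2 (A)/(B), §3 (a), work package W7 "properness", owner w4-d031).

The cover is `D_e : r^e = x(1−x)` (`e = 2k − 1` odd), `s := 1 − 2x`, and the function is
`t := r⁻¹ + r^k / s` with SIMPLE POLES at `Q_0 = (0,0)`, `Q_1 = (1,0)`, the Weierstrass points
`s = 0`, and `Q_∞`. Away from the poles `t − b = D_b/(r·s)` with the POLYNOMIAL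
`D_b := s + r^{k+1} − b·r·s`, whose zeros ON THE CURVE are exactly the fibre `t⁻¹(b)` (at a pole
`D_b` equals `±1` resp. `r^{k+1} ≠ 0`). Consequently:

* near `Q_∞` (`‖x‖ ≥ R_∞`) one has `‖t‖ ≥ T` for any prescribed `T` (`norm_t_ge_of_norm_x_ge`: from
  `‖r‖^{2k} = ‖r‖·‖x‖·‖1−x‖` and `‖s‖ ≤ 1 + 2‖x‖`);
* on the bounded part `‖x‖ ≤ R`, for points of a COMPACT set of curve points `ρ`-far from a set
  `Z ⊇ t⁻¹(b)`, `‖D_b‖` is bounded below by a positive constant (minimum of a continuous nonvanishing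
  function on a compact set, `exists_pos_le_norm_of_compact`), hence so is
  `‖t − b‖ = ‖D_b‖/‖r s‖` (`‖r s‖ ≤ C_R`);
* assembled: `exists_lower_bound_t_sub` — for a finite set `B` and `Z ⊇ ⋃_{b ∈ B} t⁻¹(b)`, every
  curve point (not a pole) in the given point-domain that is `ρ`-far from `Z` satisfies
  `ρ_t ≤ ‖t − b‖` for all `b ∈ B`, with one `ρ_t > 0`.

The compactness hypothesis is supplied (i) over a proper normed field (`ℂ`):
`isCompact_curveFar_of_properSpace`, and (ii) over `Q̄_p` for points with coordinates in a fixed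
finite extension `K/ℚ_p` (`isCompact_curveFar_of_intermediateField`, the finite-dimensional
`ℚ_p`-space `K` being proper — the printed "over any finite extension of `ℚ_v`"). No definitions
(proof-only); the expressions `1 − 2x`, `r⁻¹ + r^k/(1 − 2x)`, `D_b` are written out. Classical
and undisputed; nothing here bears on [IUTchIII] Cor. 3.12.
-/

namespace Literature.NumberTheory.DiophantineGeometry.GenEll

open Metric Set

/-! ### Generic engine: a continuous nonvanishing function on a compact set is bounded below -/

section Engine

variable {X E : Type*} [TopologicalSpace X] [NormedAddCommGroup E]

/-- On a compact set, a continuous function that does not vanish is bounded below in norm by a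
positive constant. [folklore] -/
private theorem exists_pos_le_norm_of_compact {S : Set X} (hS : IsCompact S) {f : X → E}
    (hf : ContinuousOn f S) (hne : ∀ P ∈ S, f P ≠ 0) :
    ∃ m : ℝ, 0 < m ∧ ∀ P ∈ S, m ≤ ‖f P‖ := by
  rcases S.eq_empty_or_nonempty with rfl | hSne
  · exact ⟨1, one_pos, fun P hP => hP.elim⟩
  obtain ⟨P₀, hP₀, hmin⟩ := hS.exists_isMinOn hSne (hf.norm)
  exact ⟨‖f P₀‖, norm_pos_iff.mpr (hne P₀ hP₀), fun P hP => hmin hP⟩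

end Engine

/-! ### The set of curve points in a window, far from a given set -/

section CurveFar

variable {L : Type*} [NormedField L]

/-- In a proper normed field (`ℂ`): the curve points `(x, r)`, `r^e = x(1−x)`, with `‖x‖ ≤ R` that
are `ρ`-far (sup-distance on `L × L`) from every point of `Z` form a compact set.
[cite: MochizukiGenEll2010, Thm 2.1 p.12] -/
theorem isCompact_curveFar_of_properSpace [ProperSpace L] {e : ℕ} (he : 0 < e) (R ρ : ℝ)
    (Z : Set (L × L)) :
    IsCompact {P : L × L | P.2 ^ e = P.1 * (1 - P.1) ∧ ‖P.1‖ ≤ R ∧ ∀ z ∈ Z, ρ ≤ dist P z} := by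
  -- closed
  have hclosed : IsClosed {P : L × L | P.2 ^ e = P.1 * (1 - P.1) ∧ ‖P.1‖ ≤ R ∧
      ∀ z ∈ Z, ρ ≤ dist P z} := by
    have h1 : IsClosed {P : L × L | P.2 ^ e = P.1 * (1 - P.1)} :=
      isClosed_eq (by fun_prop) (by fun_prop)
    have h2 : IsClosed {P : L × L | ‖P.1‖ ≤ R} :=
      isClosed_le (by fun_prop) continuous_const
    have h3 : IsClosed {P : L × L | ∀ z ∈ Z, ρ ≤ dist P z} := by
      have : {P : L × L | ∀ z ∈ Z, ρ ≤ dist P z} = ⋂ z ∈ Z, {P | ρ ≤ dist P z} := by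
        ext P; simp
      rw [this]
      exact isClosed_biInter fun z _ => isClosed_le continuous_const (continuous_id.dist continuous_const)
    simpa only [Set.setOf_and] using h1.inter (h2.inter h3)
  -- bounded: ‖x‖ ≤ R and ‖r‖ ≤ max 1 (R (1 + R))
  have hbdd : Bornology.IsBounded {P : L × L | P.2 ^ e = P.1 * (1 - P.1) ∧ ‖P.1‖ ≤ R ∧
      ∀ z ∈ Z, ρ ≤ dist P z} := by
    refine (Metric.isBounded_closedBall (x := (0 : L × L))
      (r := max R (max 1 (R * (1 + R))))).subset ?_
    rintro ⟨x, r⟩ ⟨hcurve, hx, -⟩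
    rw [mem_closedBall, dist_zero_right, Prod.norm_def]
    refine max_le (hx.trans (le_max_left _ _)) ((?_ : ‖r‖ ≤ max 1 (R * (1 + R))).trans (le_max_right _ _))
    by_cases hr : ‖r‖ ≤ 1
    · exact hr.trans (le_max_left _ _)
    · have hr1 : 1 < ‖r‖ := lt_of_not_ge hr
      have hre : ‖r‖ ≤ ‖r‖ ^ e := le_self_pow₀ hr1.le he.ne'
      have : ‖r‖ ^ e = ‖x‖ * ‖1 - x‖ := by rw [← norm_pow, hcurve, norm_mul]
      have h1x : ‖1 - x‖ ≤ 1 + R := (norm_sub_le 1 x).trans (by simp [hx])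
      have hR : 0 ≤ R := (norm_nonneg x).trans hx
      calc ‖r‖ ≤ ‖r‖ ^ e := hre
        _ = ‖x‖ * ‖1 - x‖ := this
        _ ≤ R * (1 + R) := mul_le_mul hx h1x (norm_nonneg _) hR
        _ ≤ max 1 (R * (1 + R)) := le_max_right _ _
  exact Metric.isCompact_of_isClosed_isBounded hclosed hbdd

/-- Over an ambient normed field `L` that is a normed algebra over a locally compact nontrivially
normed field `𝕜` (`L = Q̄_p`, `𝕜 = ℚ_p`): the curve points with BOTH coordinates in a fixed
finite-dimensional `𝕜`-submodule `K ⊆ L` (a finite extension `K/ℚ_p`, "the set of rational points …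
over any finite extension of `ℚ_v`"), with `‖x‖ ≤ R`, `ρ`-far from `Z ⊆ L × L`, form a compact set —
`K × K` is a proper space. [cite: MochizukiGenEll2010, Thm 2.1 p.12] -/
theorem isCompact_curveFar_of_submodule {𝕜 : Type*} [NontriviallyNormedField 𝕜]
    [LocallyCompactSpace 𝕜] [NormedSpace 𝕜 L] (K : Submodule 𝕜 L) [FiniteDimensional 𝕜 K]
    {e : ℕ} (he : 0 < e) (R ρ : ℝ) (Z : Set (L × L)) :
    IsCompact {P : L × L | (P.1 ∈ K ∧ P.2 ∈ K) ∧ P.2 ^ e = P.1 * (1 - P.1) ∧ ‖P.1‖ ≤ R ∧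
      ∀ z ∈ Z, ρ ≤ dist P z} := by
  haveI : ProperSpace K := FiniteDimensional.proper 𝕜 K
  -- the inclusion `K × K → L × L`
  let ι : K × K → L × L := fun Q => ((Q.1 : L), (Q.2 : L))
  have hι : Continuous ι := by fun_prop
  -- the set upstairs
  let S' : Set (K × K) := {Q | (Q.2 : L) ^ e = (Q.1 : L) * (1 - (Q.1 : L)) ∧ ‖(Q.1 : L)‖ ≤ R ∧
    ∀ z ∈ Z, ρ ≤ dist (ι Q) z}
  have hS'closed : IsClosed S' := by
    have h1 : IsClosed {Q : K × K | (Q.2 : L) ^ e = (Q.1 : L) * (1 - (Q.1 : L))} :=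
      isClosed_eq (by fun_prop) (by fun_prop)
    have h2 : IsClosed {Q : K × K | ‖(Q.1 : L)‖ ≤ R} :=
      isClosed_le (by fun_prop) continuous_const
    have h3 : IsClosed {Q : K × K | ∀ z ∈ Z, ρ ≤ dist (ι Q) z} := by
      have : {Q : K × K | ∀ z ∈ Z, ρ ≤ dist (ι Q) z} = ⋂ z ∈ Z, {Q | ρ ≤ dist (ι Q) z} := by
        ext Q; simp
      rw [this]
      exact isClosed_biInter fun z _ => isClosed_le continuous_const (hι.dist continuous_const)
    simpa only [S', Set.setOf_and] using h1.inter (h2.inter h3)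
  have hS'bdd : Bornology.IsBounded S' := by
    refine (Metric.isBounded_closedBall (x := (0 : K × K))
      (r := max R (max 1 (R * (1 + R))))).subset ?_
    rintro ⟨x, r⟩ ⟨hcurve, hx, -⟩
    rw [mem_closedBall, dist_zero_right, Prod.norm_def]
    have hxK : ‖x‖ = ‖(x : L)‖ := rfl
    have hrK : ‖r‖ = ‖(r : L)‖ := rfl
    rw [hxK, hrK]
    refine max_le (hx.trans (le_max_left _ _))
      ((?_ : ‖(r : L)‖ ≤ max 1 (R * (1 + R))).trans (le_max_right _ _))
    by_cases hr : ‖(r : L)‖ ≤ 1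
    · exact hr.trans (le_max_left _ _)
    · have hr1 : 1 < ‖(r : L)‖ := lt_of_not_ge hr
      have hre : ‖(r : L)‖ ≤ ‖(r : L)‖ ^ e := le_self_pow₀ hr1.le he.ne'
      have : ‖(r : L)‖ ^ e = ‖(x : L)‖ * ‖1 - (x : L)‖ := by rw [← norm_pow, hcurve, norm_mul]
      have h1x : ‖1 - (x : L)‖ ≤ 1 + R := (norm_sub_le 1 (x : L)).trans (by simp [hx])
      have hR : 0 ≤ R := (norm_nonneg _).trans hx
      calc ‖(r : L)‖ ≤ ‖(r : L)‖ ^ e := hre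
        _ = ‖(x : L)‖ * ‖1 - (x : L)‖ := this
        _ ≤ R * (1 + R) := mul_le_mul hx h1x (norm_nonneg _) hR
        _ ≤ max 1 (R * (1 + R)) := le_max_right _ _
  have hS'cpt : IsCompact S' := Metric.isCompact_of_isClosed_isBounded hS'closed hS'bdd
  -- the set downstairs is the image
  have himg : {P : L × L | (P.1 ∈ K ∧ P.2 ∈ K) ∧ P.2 ^ e = P.1 * (1 - P.1) ∧ ‖P.1‖ ≤ R ∧
      ∀ z ∈ Z, ρ ≤ dist P z} = ι '' S' := by
    ext ⟨x, r⟩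
    simp only [Set.mem_setOf_eq, Set.mem_image]
    constructor
    · rintro ⟨⟨hx, hr⟩, hc, hR, hz⟩
      exact ⟨(⟨x, hx⟩, ⟨r, hr⟩), ⟨hc, hR, hz⟩, rfl⟩
    · rintro ⟨⟨x', r'⟩, ⟨hc, hR, hz⟩, h⟩
      simp only [ι, Prod.mk.injEq] at h
      obtain ⟨rfl, rfl⟩ := h
      exact ⟨⟨x'.2, r'.2⟩, hc, hR, hz⟩
  rw [himg]
  exact hS'cpt.image hι

/-! ### The cover `D_e` and the function `t = r⁻¹ + r^k/(1 − 2x)`: elementary estimates -/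

/-- `‖1 − 2x‖ ≤ 1 + 2‖x‖`. [folklore] -/
private theorem norm_one_sub_two_mul_le (x : L) : ‖1 - 2 * x‖ ≤ 1 + 2 * ‖x‖ := by
  calc ‖1 - 2 * x‖ ≤ ‖(1 : L)‖ + ‖2 * x‖ := norm_sub_le _ _
    _ ≤ 1 + 2 * ‖x‖ := by
        rw [norm_one]
        gcongr
        calc ‖2 * x‖ = ‖x + x‖ := by rw [two_mul]
          _ ≤ ‖x‖ + ‖x‖ := norm_add_le x x
          _ = 2 * ‖x‖ := by ring

/-- On the curve `r^e = x(1−x)` (`e ≥ 1`), `‖x‖ ≤ R` bounds `‖r‖ ≤ max 1 (R(1+R))`. [folklore] -/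
private theorem norm_r_le_of_norm_x_le {e : ℕ} (he : 0 < e) {x r : L} (hcurve : r ^ e = x * (1 - x))
    {R : ℝ} (hx : ‖x‖ ≤ R) : ‖r‖ ≤ max 1 (R * (1 + R)) := by
  by_cases hr : ‖r‖ ≤ 1
  · exact hr.trans (le_max_left _ _)
  · have hr1 : 1 < ‖r‖ := lt_of_not_ge hr
    have hre : ‖r‖ ≤ ‖r‖ ^ e := le_self_pow₀ hr1.le he.ne'
    have : ‖r‖ ^ e = ‖x‖ * ‖1 - x‖ := by rw [← norm_pow, hcurve, norm_mul]
    have h1x : ‖1 - x‖ ≤ 1 + R := (norm_sub_le 1 x).trans (by simp [hx])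
    have hR : 0 ≤ R := (norm_nonneg x).trans hx
    calc ‖r‖ ≤ ‖r‖ ^ e := hre
      _ = ‖x‖ * ‖1 - x‖ := this
      _ ≤ R * (1 + R) := mul_le_mul hx h1x (norm_nonneg _) hR
      _ ≤ max 1 (R * (1 + R)) := le_max_right _ _

/-- On the curve, `‖x‖ ≤ R` bounds `‖r · (1 − 2x)‖ ≤ max 1 (R(1+R)) · (1 + 2R)`. [folklore] -/
private theorem norm_r_mul_s_le {e : ℕ} (he : 0 < e) {x r : L} (hcurve : r ^ e = x * (1 - x))
    {R : ℝ} (hx : ‖x‖ ≤ R) : ‖r * (1 - 2 * x)‖ ≤ max 1 (R * (1 + R)) * (1 + 2 * R) := by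
  rw [norm_mul]
  have hR : 0 ≤ R := (norm_nonneg x).trans hx
  exact mul_le_mul (norm_r_le_of_norm_x_le he hcurve hx)
    ((norm_one_sub_two_mul_le x).trans (by linarith)) (norm_nonneg _)
    (zero_le_one.trans (le_max_left _ _))

/-- Away from the poles (`r ≠ 0`, `1 − 2x ≠ 0`): `t − b = D_b / (r·(1−2x))` with the POLYNOMIAL
numerator `D_b = (1 − 2x) + r^{k+1} − b·r·(1 − 2x)`. [folklore] -/
private theorem t_sub_eq_div {x r : L} (hr : r ≠ 0) (hs : 1 - 2 * x ≠ 0) (k : ℕ) (b : L) :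
    r⁻¹ + r ^ k / (1 - 2 * x) - b =
      ((1 - 2 * x) + r ^ (k + 1) - b * r * (1 - 2 * x)) / (r * (1 - 2 * x)) := by
  field_simp
  ring

/-- The numerator `D_b` does NOT vanish at the poles lying on the affine curve: if `r^e = x(1−x)`
and `r = 0` then `x ∈ {0, 1}` and `D_b = 1 − 2x = ±1`; if `1 − 2x = 0` then `D_b = r^{k+1}` with
`r ≠ 0`. Hence a zero of `D_b` on the curve is a point of the fibre `t⁻¹(b)`. [folklore] -/
private theorem t_eq_of_numerator_eq_zero {e : ℕ} (he : 0 < e) {x r : L} (hcurve : r ^ e = x * (1 - x))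
    {k : ℕ} {b : L} (hD : (1 - 2 * x) + r ^ (k + 1) - b * r * (1 - 2 * x) = 0) :
    r ≠ 0 ∧ 1 - 2 * x ≠ 0 ∧ r⁻¹ + r ^ k / (1 - 2 * x) = b := by
  have hr : r ≠ 0 := by
    rintro rfl
    rw [zero_pow he.ne'] at hcurve
    have hx : x = 0 ∨ x = 1 := by
      rcases mul_eq_zero.mp hcurve.symm with h | h
      · exact Or.inl h
      · exact Or.inr (by linear_combination -h)
    rw [zero_pow (Nat.succ_ne_zero k), mul_zero, zero_mul, sub_zero, add_zero] at hD
    rcases hx with rfl | rfl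
    · simp at hD
    · norm_num at hD
  have hs : 1 - 2 * x ≠ 0 := by
    intro hs
    rw [hs, mul_zero, sub_zero, zero_add] at hD
    exact pow_ne_zero _ hr hD
  refine ⟨hr, hs, ?_⟩
  have h := t_sub_eq_div hr hs k b
  rw [hD, zero_div, sub_eq_zero] at h
  exact h

/-- **Near `Q_∞`, `t` is large**: for every `T` there is `R` such that every curve point
`r^e = x(1−x)` (`e = 2k − 1 ≥ 1`) with `‖x‖ ≥ R` that is not a Weierstrass point (`1 − 2x ≠ 0`)
has `T ≤ ‖t‖`, `t = r⁻¹ + r^k/(1 − 2x)`. (From `‖r‖^{2k} = ‖r‖·‖x‖·‖1−x‖ ≥ ‖r‖‖x‖²/2` and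
`‖1 − 2x‖ ≤ 3‖x‖`: `‖r^k/(1−2x)‖² ≥ ‖r‖/18 → ∞`.) [cite: MochizukiGenEll2010, Thm 2.1 p.12] -/
theorem exists_norm_t_ge_of_norm_x_ge {e k : ℕ} (he : 0 < e) (hk : 2 * k = e + 1) (T : ℝ) :
    ∃ R : ℝ, 0 < R ∧ ∀ x r : L, r ^ e = x * (1 - x) → 1 - 2 * x ≠ 0 → R ≤ ‖x‖ →
      T ≤ ‖r⁻¹ + r ^ k / (1 - 2 * x)‖ := by
  -- constants
  set L₀ : ℝ := max 1 (18 * (T + 1) ^ 2) with hL₀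
  have hL₀1 : 1 ≤ L₀ := le_max_left _ _
  have hL₀0 : 0 < L₀ := lt_of_lt_of_le one_pos hL₀1
  have hL₀T : 18 * (T + 1) ^ 2 ≤ L₀ := le_max_right _ _
  set R : ℝ := max 2 (2 * L₀ ^ e) with hR
  have hR2 : 2 ≤ R := le_max_left _ _
  have hRL : 2 * L₀ ^ e ≤ R := le_max_right _ _
  refine ⟨R, by linarith, fun x r hcurve hs hx => ?_⟩
  have hx2 : 2 ≤ ‖x‖ := hR2.trans hx
  have hx0 : 0 < ‖x‖ := by linarith
  -- ‖1 - x‖ ≥ ‖x‖/2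
  have h1x : ‖x‖ / 2 ≤ ‖1 - x‖ := by
    have := norm_sub_norm_le x 1
    rw [norm_one, ← norm_neg (x - 1), neg_sub] at this
    linarith
  -- ‖r‖^e ≥ L₀^e, hence ‖r‖ ≥ L₀
  have hre : ‖r‖ ^ e = ‖x‖ * ‖1 - x‖ := by rw [← norm_pow, hcurve, norm_mul]
  have hre_ge : L₀ ^ e ≤ ‖r‖ ^ e := by
    rw [hre]
    have h1 : ‖x‖ * (‖x‖ / 2) ≤ ‖x‖ * ‖1 - x‖ := mul_le_mul_of_nonneg_left h1x hx0.le
    have h2 : L₀ ^ e ≤ ‖x‖ * (‖x‖ / 2) := by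
      have : 2 * L₀ ^ e ≤ ‖x‖ := hRL.trans hx
      nlinarith
    exact h2.trans h1
  have hrL : L₀ ≤ ‖r‖ := (pow_le_pow_iff_left₀ hL₀0.le (norm_nonneg r) he.ne').mp hre_ge
  have hr0 : 0 < ‖r‖ := lt_of_lt_of_le hL₀0 hrL
  -- ‖s‖ ≤ 3‖x‖ and 0 < ‖s‖
  have hs3 : ‖1 - 2 * x‖ ≤ 3 * ‖x‖ := (norm_one_sub_two_mul_le x).trans (by linarith)
  have hs0 : 0 < ‖1 - 2 * x‖ := norm_pos_iff.mpr hs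
  -- ‖r‖^(2k) = ‖r‖ * ‖r‖^e ≥ ‖r‖ ‖x‖²/2
  have hr2k : ‖r‖ ^ (2 * k) = ‖r‖ * (‖x‖ * ‖1 - x‖) := by
    rw [hk, pow_succ', hre]
  -- the square of ‖r^k / s‖
  have hq : (T + 1) ^ 2 ≤ (‖r‖ ^ k / ‖1 - 2 * x‖) ^ 2 := by
    rw [div_pow, ← pow_mul, mul_comm k 2, hr2k, le_div_iff₀ (pow_pos hs0 2)]
    -- (T+1)^2 * ‖s‖^2 ≤ (T+1)^2 * 9 ‖x‖^2 ≤ (L₀/18)*9*... use ‖r‖ ≥ L₀ ≥ 18 (T+1)^2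
    have h1 : (T + 1) ^ 2 * ‖1 - 2 * x‖ ^ 2 ≤ (T + 1) ^ 2 * (3 * ‖x‖) ^ 2 := by
      gcongr
    have h2 : (T + 1) ^ 2 * (3 * ‖x‖) ^ 2 ≤ ‖r‖ * (‖x‖ * (‖x‖ / 2)) := by
      have : 18 * (T + 1) ^ 2 ≤ ‖r‖ := hL₀T.trans hrL
      nlinarith [sq_nonneg ‖x‖, sq_nonneg (T + 1)]
    have h3 : ‖r‖ * (‖x‖ * (‖x‖ / 2)) ≤ ‖r‖ * (‖x‖ * ‖1 - x‖) :=
      mul_le_mul_of_nonneg_left (mul_le_mul_of_nonneg_left h1x hx0.le) hr0.le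
    exact h1.trans (h2.trans h3)
  have hmain : T + 1 ≤ ‖r ^ k / (1 - 2 * x)‖ := by
    rw [norm_div, norm_pow]
    have hnn : 0 ≤ ‖r‖ ^ k / ‖1 - 2 * x‖ := by positivity
    by_cases hT : 0 ≤ T + 1
    · exact (pow_le_pow_iff_left₀ hT hnn two_ne_zero).mp hq
    · exact (lt_of_not_ge hT).le.trans hnn
  have hinv : ‖r⁻¹‖ ≤ 1 := by
    rw [norm_inv]
    exact inv_le_one_of_one_le₀ (hL₀1.trans hrL)
  -- ‖a + b‖ ≥ ‖b‖ - ‖a‖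
  have := norm_sub_norm_le (r ^ k / (1 - 2 * x)) (-r⁻¹)
  rw [norm_neg, sub_neg_eq_add, add_comm] at this
  linarith

/-! ### Uniform positive lower bounds over a finite index set -/

/-- Finite minimum of positive witnesses: if every `b ∈ B` admits some `m > 0` with a property that
is inherited by smaller positive `m`, then one `m > 0` works for all `b ∈ B`. [folklore] -/
private theorem Finset.exists_pos_forall_of_antitone {α : Type*} (B : Finset α) (Q : α → ℝ → Prop)
    (hmono : ∀ b m m', 0 < m' → m' ≤ m → Q b m → Q b m')
    (h : ∀ b ∈ B, ∃ m : ℝ, 0 < m ∧ Q b m) : ∃ m : ℝ, 0 < m ∧ ∀ b ∈ B, Q b m := by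
  classical
  induction B using Finset.induction_on with
  | empty => exact ⟨1, one_pos, by simp⟩
  | insert a B ha ih =>
    obtain ⟨m₁, hm₁, hQ₁⟩ := h a (Finset.mem_insert_self a B)
    obtain ⟨m₂, hm₂, hQ₂⟩ := ih fun b hb => h b (Finset.mem_insert_of_mem hb)
    refine ⟨min m₁ m₂, lt_min hm₁ hm₂, fun b hb => ?_⟩
    rcases Finset.mem_insert.mp hb with rfl | hb
    · exact hmono _ _ _ (lt_min hm₁ hm₂) (min_le_left _ _) hQ₁
    · exact hmono _ _ _ (lt_min hm₁ hm₂) (min_le_right _ _) (hQ₂ b hb)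

/-! ### The lower bound for `‖t − b‖` away from the fibres -/

/-- **W7-t.** Let `e = 2k − 1 ≥ 1`, `B ⊆ L` finite, and `Z ⊆ L × L` a set containing every point of
every fibre `t⁻¹(b)`, `b ∈ B`, of `t = r⁻¹ + r^k/(1 − 2x)` on the affine curve `r^e = x(1−x)` minus
its poles. Let `D ⊆ L × L` be a point-domain such that, for every `R`, the curve points of `D` with
`‖x‖ ≤ R` that are `ρ`-far from `Z` form a compact set (e.g. all of `ℂ × ℂ`, or `K × K` for a finite
extension `K/ℚ_p` inside `Q̄_p`: `isCompact_curveFar_of_properSpace` / `_of_submodule`). Then there is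
ONE `ρ_t > 0` such that every non-pole curve point of `D` that is `ρ`-far from `Z` satisfies
`ρ_t ≤ ‖t − b‖` for all `b ∈ B`. [cite: MochizukiGenEll2010, Thm 2.1 p.12] -/
theorem exists_lower_bound_t_sub {e k : ℕ} (he : 0 < e) (hk : 2 * k = e + 1) (B : Finset L)
    (Z : Set (L × L))
    (hZ : ∀ b ∈ B, ∀ P : L × L, P.2 ^ e = P.1 * (1 - P.1) → P.2 ≠ 0 → 1 - 2 * P.1 ≠ 0 →
      P.2⁻¹ + P.2 ^ k / (1 - 2 * P.1) = b → P ∈ Z)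
    {ρ : ℝ} (hρ : 0 < ρ) (D : Set (L × L))
    (hD : ∀ R : ℝ, IsCompact {P : L × L | P ∈ D ∧ P.2 ^ e = P.1 * (1 - P.1) ∧ ‖P.1‖ ≤ R ∧
      ∀ z ∈ Z, ρ ≤ dist P z}) :
    ∃ ρt : ℝ, 0 < ρt ∧ ∀ P ∈ D, P.2 ^ e = P.1 * (1 - P.1) → P.2 ≠ 0 → 1 - 2 * P.1 ≠ 0 →
      (∀ z ∈ Z, ρ ≤ dist P z) → ∀ b ∈ B, ρt ≤ ‖P.2⁻¹ + P.2 ^ k / (1 - 2 * P.1) - b‖ := by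
  -- a bound for the norms of the elements of `B`
  set M : ℝ := ∑ b ∈ B, ‖b‖ with hM
  have hMb : ∀ b ∈ B, ‖b‖ ≤ M := fun b hb =>
    Finset.single_le_sum (f := fun b => ‖b‖) (fun _ _ => norm_nonneg _) hb
  -- the radius beyond which `‖t‖ ≥ M + 1`
  obtain ⟨R, hR0, hRt⟩ := exists_norm_t_ge_of_norm_x_ge (L := L) he hk (M + 1)
  -- the bound for ‖r s‖ on ‖x‖ ≤ R
  set C : ℝ := max 1 (R * (1 + R)) * (1 + 2 * R) with hC
  have hC0 : 0 < C := by positivity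
  -- the compact far-set at radius R
  set S : Set (L × L) := {P : L × L | P ∈ D ∧ P.2 ^ e = P.1 * (1 - P.1) ∧ ‖P.1‖ ≤ R ∧
    ∀ z ∈ Z, ρ ≤ dist P z} with hS
  have hScpt : IsCompact S := hD R
  -- per `b ∈ B`: a positive lower bound for `‖D_b‖` on `S`
  have hper : ∀ b ∈ B, ∃ m : ℝ, 0 < m ∧ ∀ P ∈ S,
      m ≤ ‖(1 - 2 * P.1) + P.2 ^ (k + 1) - b * P.2 * (1 - 2 * P.1)‖ := by
    intro b hb
    refine exists_pos_le_norm_of_compact hScpt (by fun_prop) ?_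
    rintro P ⟨-, hcurve, -, hfar⟩ hD0
    obtain ⟨hr, hs, ht⟩ := t_eq_of_numerator_eq_zero he hcurve hD0
    have hPZ : P ∈ Z := hZ b hb P hcurve hr hs ht
    have := hfar P hPZ
    rw [dist_self] at this
    exact absurd this (not_le.mpr hρ)
  obtain ⟨m, hm0, hm⟩ := Finset.exists_pos_forall_of_antitone B
    (fun b m => ∀ P ∈ S, m ≤ ‖(1 - 2 * P.1) + P.2 ^ (k + 1) - b * P.2 * (1 - 2 * P.1)‖)
    (fun b m m' _ hle h P hP => hle.trans (h P hP)) hper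
  -- the uniform constant
  refine ⟨min 1 (m / C), lt_min one_pos (div_pos hm0 hC0), ?_⟩
  rintro ⟨x, r⟩ hPD hcurve hr hs hfar b hb
  dsimp only at hcurve hr hs ⊢
  by_cases hxR : ‖x‖ ≤ R
  · -- bounded part: ‖t - b‖ = ‖D_b‖ / ‖r s‖ ≥ m / C
    have hmem : ((x, r) : L × L) ∈ S := ⟨hPD, hcurve, hxR, hfar⟩
    have hDb : m ≤ ‖(1 - 2 * x) + r ^ (k + 1) - b * r * (1 - 2 * x)‖ := hm b hb (x, r) hmem
    have hrs : ‖r * (1 - 2 * x)‖ ≤ C := norm_r_mul_s_le he hcurve hxR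
    have hrs0 : 0 < ‖r * (1 - 2 * x)‖ := norm_pos_iff.mpr (mul_ne_zero hr hs)
    rw [t_sub_eq_div hr hs k b, norm_div]
    calc min 1 (m / C) ≤ m / C := min_le_right _ _
      _ ≤ m / ‖r * (1 - 2 * x)‖ := div_le_div_of_nonneg_left hm0.le hrs0 hrs
      _ ≤ ‖(1 - 2 * x) + r ^ (k + 1) - b * r * (1 - 2 * x)‖ / ‖r * (1 - 2 * x)‖ :=
          div_le_div_of_nonneg_right hDb hrs0.le
  · -- near Q_∞: ‖t‖ ≥ M + 1 ≥ ‖b‖ + 1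
    have hxR' : R ≤ ‖x‖ := (lt_of_not_ge hxR).le
    have ht : M + 1 ≤ ‖r⁻¹ + r ^ k / (1 - 2 * x)‖ := hRt x r hcurve hs hxR'
    have h1 : ‖r⁻¹ + r ^ k / (1 - 2 * x)‖ - ‖b‖ ≤ ‖r⁻¹ + r ^ k / (1 - 2 * x) - b‖ :=
      norm_sub_norm_le _ _
    have h2 := hMb b hb
    calc min 1 (m / C) ≤ 1 := min_le_left _ _
      _ ≤ ‖r⁻¹ + r ^ k / (1 - 2 * x) - b‖ := by linarith

end CurveFar

end Literature.NumberTheory.DiophantineGeometry.GenEll
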